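import Literature.IUT.HodgeTheaters.LocalFrobenioidsArch
import Mathlib.Analysis.SpecificLimits.Normed
import Mathlib.Topology.Algebra.Order.Archimedean
import Mathlib.Topology.Algebra.Algebra
import HarnessLib

/-!
# [IUTchI] Example 3.4 (ii): `(𝒪^▷(C⊢_v), τ⊢_v) ≅ D⊢_v` in `TM⊢` — PROVED for every instance of the interface

S. Mochizuki, *Inter-universal Teichmüller theory I*, §3, Example 3.4 "Frobenioids at Archimedean Primes"
(ii), kurims final manuscript May 2020 p. 81 [claim: Mochizuki2012, status: disputed]: "we obtain a natural
Frobenioid `C⊢_v := C_v` … the resulting characteristic splitting `τ⊢_v` … so that we may think of the pair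
`(𝒪^▷(C⊢_v), τ⊢_v)` as the object of `TM⊢` determined by `K_v`; moreover the object `(𝒪^▷(C⊢_v), τ⊢_v)` of
`TM⊢` is isomorphic to `D⊢_v`" [`D⊢_v` = the object of `TM⊢` determined by the CAF `𝒜_{D_v}`].

PROOF-ONLY companion of `LocalFrobenioidsArch.lean` (abc-iut-L5-t2, p404560), where that sentence is the
ONE statement of Example 3.4 typed as an unproved `Prop`, `ArchLocalFrobenioid.DashIsoDdash X` (an
isomorphism of monoids `𝒪^▷(C⊢_v) ⥲ 𝒪^▷_{𝒜_{D_v}}`, bicontinuous, carrying `τ⊢_v` onto `(0, 1]`). THIS FILE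
proves it for EVERY `X : ArchLocalFrobenioid K_v` (abc-iut DAG node `IUTchI:Ex3.4(ii)`; (i)/(iii) are data),
from the two "natural isomorphisms" the interface records — `𝒪^▷(C_v) ⥲ 𝒪^▷_{K_v}` (`isoOK`) and the
topological field isomorphism `K_v ⥲ 𝒜_{D_v}` (`fieldIso`) — and two facts of elementary analysis:

* a bicontinuous ring isomorphism of normed fields carries the punctured closed unit disc
  `𝒪^▷ = {0 < ‖z‖ ≤ 1}` onto the punctured closed unit disc (`‖z‖ < 1 ⟺ zⁿ → 0` is topological, and
  `‖z‖ ≤ 1 ⟺ ¬ ‖z⁻¹‖ < 1` for `z ≠ 0`) — `RingEquiv.norm_le_one_iff_of_continuous`,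
  `RingEquiv.exists_unitDiscMonoid_mulEquiv`;
* a continuous ring homomorphism between fields that are normed `ℝ`-algebras commutes with the structure
  maps from `ℝ` (ring homomorphisms fix `ℚ`, which is dense in `ℝ`) — `RingHom.map_algebraMap_real_of_continuous`;
  hence it carries the "positive reals" `(0, 1]` onto `(0, 1]`.

Theorems only (no new definitions, no named facts; the elementary-analysis steps are `private` folklore
helpers); nothing of the series' disputed content is involved: the statement is about the INTERFACE's own
two isomorphisms.
-/

namespace Literature.IUT.HodgeTheaters

open _root_.Filter
open scoped _root_.Topology

universe u

/-! ### Bicontinuous isomorphisms of normed fields preserve the punctured closed unit disc -/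

section NormedFields

variable {K L : Type*} [NormedField K] [NormedField L]

/-- A continuous ring homomorphism of normed fields maps the open unit disc into the open unit disc:
`‖z‖ < 1 ⟺ zⁿ → 0`, a condition preserved by continuous ring homomorphisms. [folklore] -/
private theorem RingHom.norm_map_lt_one_of_continuous (φ : K →+* L) (hφ : Continuous φ) {z : K}
    (hz : ‖z‖ < 1) : ‖φ z‖ < 1 := by
  rw [← tendsto_pow_atTop_nhds_zero_iff_norm_lt_one] at hz ⊢
  have h : Tendsto (fun n : ℕ => φ (z ^ n)) atTop (𝓝 (φ 0)) := (hφ.tendsto 0).comp hz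
  simpa only [map_pow, map_zero] using h

/-- A bicontinuous ring isomorphism of normed fields preserves `‖z‖ ≤ 1` for `z ≠ 0` (apply the
open-disc statement to `z⁻¹` and to the inverse isomorphism). [folklore] -/
private theorem RingEquiv.norm_le_one_iff_of_continuous (φ : K ≃+* L) (hφ : Continuous φ)
    (hφ' : Continuous φ.symm) {z : K} (hz : z ≠ 0) : ‖φ z‖ ≤ 1 ↔ ‖z‖ ≤ 1 := by
  constructor
  · intro h
    by_contra hlt
    rw [not_le] at hlt
    have hinv : ‖z⁻¹‖ < 1 := by
      rw [norm_inv]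
      exact inv_lt_one_of_one_lt₀ hlt
    have h1 : ‖φ.toRingHom z⁻¹‖ < 1 := RingHom.norm_map_lt_one_of_continuous φ.toRingHom hφ hinv
    rw [RingEquiv.toRingHom_eq_coe, RingEquiv.coe_toRingHom, map_inv₀, norm_inv] at h1
    have hpos : 0 < ‖φ z‖ := norm_pos_iff.2 ((map_ne_zero φ).2 hz)
    exact absurd ((inv_lt_one₀ hpos).1 h1) (not_lt.2 h)
  · intro h
    by_contra hlt
    rw [not_le] at hlt
    have hinv : ‖(φ z)⁻¹‖ < 1 := by
      rw [norm_inv]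
      exact inv_lt_one_of_one_lt₀ hlt
    have h1 : ‖φ.symm.toRingHom (φ z)⁻¹‖ < 1 :=
      RingHom.norm_map_lt_one_of_continuous φ.symm.toRingHom hφ' hinv
    rw [RingEquiv.toRingHom_eq_coe, RingEquiv.coe_toRingHom, map_inv₀, RingEquiv.symm_apply_apply,
      norm_inv] at h1
    have hpos : 0 < ‖z‖ := norm_pos_iff.2 hz
    exact absurd ((inv_lt_one₀ hpos).1 h1) (not_lt.2 h)

/-- A bicontinuous ring isomorphism of normed fields maps `𝒪^▷_K = {z ≠ 0, ‖z‖ ≤ 1}` into `𝒪^▷_L`.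
[folklore] -/
private theorem RingEquiv.map_mem_unitDiscMonoid (φ : K ≃+* L) (hφ : Continuous φ)
    (hφ' : Continuous φ.symm) {z : K} (hz : z ∈ unitDiscMonoid K) : φ z ∈ unitDiscMonoid L :=
  ⟨(map_ne_zero φ).2 hz.1, (RingEquiv.norm_le_one_iff_of_continuous φ hφ hφ' hz.1).2 hz.2⟩

/-- A bicontinuous ring isomorphism `φ : K ⥲ L` of normed fields restricts to a bicontinuous isomorphism of
topological monoids `𝒪^▷_K ⥲ 𝒪^▷_L` (given by `φ` on underlying elements, with inverse given by `φ⁻¹`).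
[folklore] -/
private theorem RingEquiv.exists_unitDiscMonoid_mulEquiv (φ : K ≃+* L) (hφ : Continuous φ)
    (hφ' : Continuous φ.symm) :
    ∃ ψ : unitDiscMonoid K ≃* unitDiscMonoid L, Continuous ψ ∧ Continuous ψ.symm ∧
      (∀ z : unitDiscMonoid K, ((ψ z : unitDiscMonoid L) : L) = φ (z : K)) ∧
        ∀ w : unitDiscMonoid L, ((ψ.symm w : unitDiscMonoid K) : K) = φ.symm (w : L) := by
  have hsymm : ∀ {w : L}, w ∈ unitDiscMonoid L → φ.symm w ∈ unitDiscMonoid K := fun hw =>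
    RingEquiv.map_mem_unitDiscMonoid φ.symm hφ' (by simpa using hφ) hw
  refine ⟨{ toFun := fun z => ⟨φ (z : K), RingEquiv.map_mem_unitDiscMonoid φ hφ hφ' z.2⟩
            invFun := fun w => ⟨φ.symm (w : L), hsymm w.2⟩
            left_inv := fun z => Subtype.ext (φ.symm_apply_apply z)
            right_inv := fun w => Subtype.ext (φ.apply_symm_apply w)
            map_mul' := fun z w => Subtype.ext (map_mul φ (z : K) (w : K)) }, ?_, ?_, fun z => rfl, fun w => rfl⟩
  · exact (hφ.comp continuous_subtype_val).subtype_mk _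
  · exact (hφ'.comp continuous_subtype_val).subtype_mk _

end NormedFields

/-! ### Continuous ring homomorphisms between normed `ℝ`-algebras commute with the structure maps -/

section RealAlgebras

variable {K L : Type*} [NormedField K] [NormedAlgebra ℝ K] [NormedField L] [NormedAlgebra ℝ L]

/-- A continuous ring homomorphism between fields that are normed `ℝ`-algebras is compatible with the
structure maps from `ℝ`: both `φ ∘ (ℝ → K)` and `ℝ → L` are continuous ring homomorphisms `ℝ → L`, they
agree on `ℚ`, and `ℚ` is dense in `ℝ`. [folklore] -/
private theorem RingHom.map_algebraMap_real_of_continuous (φ : K →+* L) (hφ : Continuous φ) (r : ℝ) :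
    φ (algebraMap ℝ K r) = algebraMap ℝ L r := by
  have hd : DenseRange ((↑) : ℚ → ℝ) := Rat.denseRange_cast
  have heq := hd.equalizer (hφ.comp (continuous_algebraMap ℝ K)) (continuous_algebraMap ℝ L)
    (funext fun q : ℚ => by
      simp only [Function.comp_apply, map_ratCast])
  exact congr_fun heq r

/-- Hence such a homomorphism maps the "positive reals" `(0, 1] ⊆ K` into the positive reals of `L`.
[folklore] -/
private theorem RingHom.map_mem_posRealMonoid_of_continuous (φ : K →+* L) (hφ : Continuous φ) {z : K}
    (hz : z ∈ posRealMonoid K) : φ z ∈ posRealMonoid L := by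
  obtain ⟨r, hr, hr', rfl⟩ := hz
  exact ⟨r, hr, hr', RingHom.map_algebraMap_real_of_continuous φ hφ r⟩

end RealAlgebras

/-! ### Example 3.4 (ii): the isomorphism `(𝒪^▷(C⊢_v), τ⊢_v) ⥲ D⊢_v` -/

namespace ArchLocalFrobenioid

variable {Kv : Type u} [NormedField Kv] [NormedAlgebra ℝ Kv]

/-- **[IUTchI] Example 3.4 (ii)** (p. 81), the sentence "the object `(𝒪^▷(C⊢_v), τ⊢_v)` of `TM⊢` is
isomorphic to `D⊢_v`" — PROVED for every instance `X` of the Example 3.4 interface (abc-iut DAG node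
`IUTchI:Ex3.4(ii)`): the composite of the recorded natural isomorphism `𝒪^▷(C_v) ⥲ 𝒪^▷_{K_v}` (Ex. 3.4 (i))
with the restriction to `𝒪^▷` of the recorded topological field isomorphism `K_v ⥲ 𝒜_{D_v}` (Ex. 3.4 (i))
is a bicontinuous isomorphism of monoids `𝒪^▷(C⊢_v) ⥲ 𝒪^▷_{𝒜_{D_v}}` carrying `τ⊢_v` (the preimage of
`(0, 1] ⊆ 𝒪^▷_{K_v}`) onto `(0, 1] ⊆ 𝒪^▷_{𝒜_{D_v}}` (a continuous field isomorphism of normed `ℝ`-algebras is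
`ℝ`-linear). [claim: Mochizuki2012, status: disputed] -/
theorem dashIsoDdash_holds (X : ArchLocalFrobenioid.{u} Kv) :
    Literature.IUT.HodgeTheaters.ArchLocalFrobenioid.DashIsoDdash X := by
  obtain ⟨ψ, hψ, hψ', hψv, hψs⟩ := RingEquiv.exists_unitDiscMonoid_mulEquiv X.fieldIso
    X.fieldIso_continuous X.fieldIso_continuous_symm
  refine ⟨X.isoOK.trans ψ, hψ.comp X.isoOK_continuous, X.isoOK_continuous_symm.comp hψ', ?_⟩
  ext w
  simp only [tauDash, Submonoid.mem_map, Submonoid.mem_comap, MulEquiv.coe_toMonoidHom,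
    Submonoid.coe_subtype, MulEquiv.trans_apply]
  constructor
  · rintro ⟨x, hx, rfl⟩
    rw [hψv]
    exact RingHom.map_mem_posRealMonoid_of_continuous X.fieldIso.toRingHom X.fieldIso_continuous hx
  · intro hw
    refine ⟨X.isoOK.symm (ψ.symm w), ?_, by simp⟩
    rw [MulEquiv.apply_symm_apply, hψs]
    exact RingHom.map_mem_posRealMonoid_of_continuous X.fieldIso.symm.toRingHom
      X.fieldIso_continuous_symm hw

end ArchLocalFrobenioid

end Literature.IUT.HodgeTheaters
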